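import Summits.SmoothPoincare4.SmoothPoincare4.Theses.DottedCircleRasmussen
import Summits.SmoothPoincare4.SmoothPoincare4.Theorems.DottedCircleRasmussenDcrGfgmw
import Literature.Topology.FourManifolds.MMSWRasmussenFactsProofs
import Literature.Topology.FourManifolds.HomotopyBallSliceProofs
import Literature.Topology.FourManifolds.DehnSurgeryTubularNbhdProofs
import Literature.Barriers.SmoothPoincare4.GluckTwistsDissolve

/-!
# Disproof of `DcrGap` — findings (crux stmt-SmoothPoincare4-16128, route `DottedCircleRasmussen`)

Standing disprover's work file (cdisprove, cycle 1).  `DcrGap` (the ONE-HANDLE SLICE GAP) reads,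
word for word (`dcrGap_iff`, `Iff.rfl`):

  `∃ k K, MMSW.IsModelKnot k K ∧ HomotopySphereSlice k K ∧ NoDisc k K`

— some smoothly embedded circle `K ⊂ ∂D_k` bounds a smooth proper disc in the complement of the
dotted handlebody `e(D_k)` inside SOME homotopy 4-sphere, but in NO smooth `N ≅ S⁴`, for NO chart `e'`.

## Findings (index; details in the docstrings below)

* §0 vocabulary: the three clauses, and `DcrGap`/`DcrRigidity` in that vocabulary (`Iff.rfl`).
* §1 NORMAL FORM OF THE NO-DISC CLAUSE (proved, no sorry): for a circle on `∂D_k`,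
  `NoDisc k K ↔ ∀ g, ¬ MMSW.IsModelSliceDisc k K g` (`noDisc_iff`) — the universal clause over all
  carriers `N`, atlases, diffeomorphisms and charts `e'` collapses to "`K` bounds no smooth proper
  disc in `ℝ⁴ ∖ D_k`" (Palais standardisation `DcrGfgmw.exists_isModelSliceDisc_or_mirror`, the
  mirror being absorbed by `IsModelSliceDisc.modelMirror_comp`; converse: push a model disc into
  `S⁴` along a stereographic chart).  Hence the crux in normal form (`dcrGap_iff_modelForm`) and the
  kill switch in normal form (`dcrRigidity_iff_modelForm`): to REFUTE the crux one must produce, for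
  every model knot sliceable in some homotopy sphere's complement, a MODEL slice disc in `ℝ⁴ ∖ D_k`.
* §2 LOAD-BEARING: the hypothesis `Nonempty (N ≃ₘ S⁴)` of the no-disc clause carries the content —
  weakened to `Nonempty (N ≃ₕ S⁴)` (or dropped) the crux is FALSE by `N := M` (`dcrGap_false_without_diffeo`).
  The chirality freedom in `e'` is NOT exploitable (`noDisc_iff`: the mirror clause is redundant).
* §3 SHIELD: `SmoothPoincare4 → ¬ DcrGap` (`not_dcrGap_of_spc4`, = contrapositive of the certified
  `closes`); a witness `M` is an exotic sphere (`isEmpty_diffeomorph_of_witness`); sharper and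
  invariant-free (LANDED `Theorems/DcrGap/Negative/NoEmbedding.lean`, p130705): NO carrier `X` of ANY
  slice datum of a witness circle embeds smoothly in `S⁴` (`not_isSmoothEmbedding_of_witness`) — a
  candidate `(Σ, e, f)` is dead once a neighbourhood of `e(ℝ⁴) ∪ f(ℝ²)` embeds in `S⁴`.  So no
  refutation short of SPC4-strength rigidity, and no proof short of an exotic `S⁴`.
* §4 HARDNESS PIN (k = 0; LANDED as `Theorems/DcrGap/Negative/KZeroIsFgmw.lean`, p130570):
  `¬ DcrGap` implies that EVERY knot that is slice in a homotopy 4-ball is slice in `B⁴`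
  (`isSmoothlySlice_of_isHomotopyBallSlice_of_not_dcrGap`), i.e. it kills the
  Freedman–Gompf–Morrison–Walker / Manolescu–Piccirillo strategy outright
  (`not_zseHsliceNotSlice_of_not_dcrGap`: `¬ DcrGap → ¬ ZeroSurgeryExotic.ZseHsliceNotSlice` by
  `Iff.rfl` of the latter), answers MMSW Question 9.11 for knots POSITIVELY modulo Rasmussen's
  slice theorem (`question911Knot_of_not_dcrGap`, barrier-catalogue vocabulary
  `Literature.Barriers.SmoothPoincare4.GluckTwistsDissolve`) and voids the `s`-strategy
  (`not_fgmwRasmussenStrategy_of_not_dcrGap`).  The `k = 0` model `D_0` is the solid ellipsoid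
  `L(B̄⁴)`, `L = diag(40,40,1,1)`; the dictionary `Knot.IsSliceDiscIn ↔ MMSW.IsSliceDiscInComplement 0`
  is exact (two landed bridge theorems).  LANDED normal form: `Theorems/DcrGap/Negative/NoDiscNormalForm.lean` (p130342).
* §5 WHY IT RESISTS / near-misses (docstrings only): no in-print `M_k`-rigidity theorem; the only
  knot-level rigidity in `S¹ × S²` (Davis–Nagel–Park–Ray 2018: winding-±1 knots are concordant to
  `S¹ × pt`) constrains WITNESSES of the `k = 1` rung, not the crux; dropping `IsModelKnot`'s
  membership clause does not make the crux cheap either (a circle off `∂D_k` still needs a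
  separating disc).  Attacks tried: degenerate `k = 0` (= FGMW, open), junk `K` (constant / interior /
  exterior circles: the datum clause fails or `NoDisc` fails), chirality (absorbed), carrier/atlas
  freedom in `N` (absorbed by transport + Palais), weakening `≃ₘ` to `≃ₕ` (false, §2).
-/

noncomputable section

-- namespace prescribed by the crux protocol (`P = Sub = SmoothPoincare4`)
set_option linter.dupNamespace false

open scoped Manifold ContDiff Topology
open Function Set
open Literature.Topology.FourManifolds Literature.Topology.FourManifolds.MMSW
open Summit.SmoothPoincare4.SmoothPoincare4.Theses.DottedCircleRasmussen

namespace Summit.SmoothPoincare4.SmoothPoincare4.Cruxes.DcrGap.Disproof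

/-- Local notation: `𝔼 n` is the model Euclidean space `EuclideanSpace ℝ (Fin n)`. -/
local notation "𝔼 " n:arg => EuclideanSpace ℝ (Fin n)

/-- Local notation: `𝕊 n` is the unit sphere in `EuclideanSpace ℝ (Fin (n + 1))`. -/
local notation "𝕊 " n:arg => (Metric.sphere (0 : EuclideanSpace ℝ (Fin (n + 1))) 1)

/-! ## §0 Vocabulary -/

/-- The POSITIVE DATUM of the crux: the model circle `K ⊂ ∂D_k` bounds a smooth proper disc in the
complement of the dotted handlebody `e(D_k)` inside SOME homotopy 4-sphere `M` (Statement binders: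
`M : Type`, Hausdorff, second countable, `C^∞` atlas on `ℝ⁴`, `M ≃ₕ S⁴`). [folklore] -/
def HomotopySphereSlice (k : ℕ) (K : 𝕊 1 → 𝔼 4) : Prop :=
  ∃ (M : Type) (_ : TopologicalSpace M) (_ : T2Space M) (_ : SecondCountableTopology M)
    (_ : ChartedSpace (𝔼 4) M) (_ : IsManifold (𝓡 4) ∞ M),
    Nonempty (ContinuousMap.HomotopyEquiv M (𝕊 4)) ∧
      ∃ (e : 𝔼 4 → M) (f : 𝔼 2 → M), IsSliceDiscInComplement k K M e f

/-- The NO-DISC CLAUSE of the crux: in no smooth 4-manifold `N` diffeomorphic to `S⁴` (any carrier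
type, any atlas) and for no smooth chart `e' : ℝ⁴ → N` does `e' ∘ K` bound a smooth proper disc in
`N ∖ e'(D_k)`. [folklore] -/
def NoDisc (k : ℕ) (K : 𝕊 1 → 𝔼 4) : Prop :=
  ∀ (N : Type) [TopologicalSpace N] [T2Space N] [SecondCountableTopology N]
    [ChartedSpace (𝔼 4) N] [IsManifold (𝓡 4) ∞ N],
    Nonempty (N ≃ₘ⟮𝓡 4, 𝓡 4⟯ (𝕊 4)) →
      ∀ (e' : 𝔼 4 → N) (f' : 𝔼 2 → N), ¬ IsSliceDiscInComplement k K N e' f'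

/-- `DcrGap` in the Literature vocabulary, definitionally. [folklore] -/
theorem dcrGap_iff :
    DcrGap ↔ ∃ (k : ℕ) (K : 𝕊 1 → 𝔼 4), IsModelKnot k K ∧ HomotopySphereSlice k K ∧ NoDisc k K :=
  Iff.rfl

/-- The kill switch `DcrRigidity = ¬ DcrGap`, definitionally. [folklore] -/
theorem dcrRigidity_iff : DcrRigidity ↔ ¬ DcrGap := Iff.rfl

/-! ## §1 Normal form of the no-disc clause: no model slice disc -/

/-- A point of `S⁴` (the first basis vector). [folklore] -/
def basePoint : 𝕊 4 := ⟨EuclideanSpace.single 0 1, by simp⟩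

/-- **A model slice disc kills the no-disc clause.** If `K` bounds a smooth proper disc `g` in
`ℝ⁴ ∖ D_k` (`MMSW.IsModelSliceDisc k K g`), then `N := S⁴`, `e' :=` the inverse stereographic
chart, `f' := e' ∘ g` is a datum the clause forbids
(`MMSW.IsModelSliceDisc.isSliceDiscInComplement_chartAt_symm`). So NO `K` with a model slice
disc is ever a witness of the crux. [folklore] -/
theorem not_noDisc_of_isModelSliceDisc {k : ℕ} {K : 𝕊 1 → 𝔼 4} {g : 𝔼 2 → 𝔼 4}
    (hg : IsModelSliceDisc k K g) : ¬ NoDisc k K := fun h =>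
  h (𝕊 4) ⟨Diffeomorph.refl _ _ _⟩ _ _ (hg.isSliceDiscInComplement_chartAt_symm basePoint)

/-- **The mirror freedom is not exploitable**: a model slice disc for the mirror `ρ ∘ K`
(`ρ(x₀,x₁,x₂,x₃) = (x₀,-x₁,x₂,x₃)` preserves `D_k`) is reflected to one for `K`
(`MMSW.IsModelSliceDisc.modelMirror_comp`), so it kills the clause too. [folklore] -/
theorem not_noDisc_of_isModelSliceDisc_mirror {k : ℕ} {K : 𝕊 1 → 𝔼 4} {g : 𝔼 2 → 𝔼 4}
    (hg : IsModelSliceDisc k (modelMirror ∘ K) g) : ¬ NoDisc k K := by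
  have h2 : IsModelSliceDisc k (modelMirror ∘ (modelMirror ∘ K)) (modelMirror ∘ g) :=
    hg.modelMirror_comp
  have hK : modelMirror ∘ (modelMirror ∘ K) = K := by
    funext t
    simp [Function.comp_apply]
  rw [hK] at h2
  exact not_noDisc_of_isModelSliceDisc h2

/-- **Standardisation**: if a circle `K ⊂ ∂D_k` bounds NO model slice disc, the no-disc clause
holds — a datum in any `N ≅ S⁴` is transported to `S⁴` and standardised by Palais' disc theorem
to a model slice disc for `K` or for `ρ ∘ K` (the tree's
`DcrGfgmw.exists_isModelSliceDisc_or_mirror_of_diffeomorph`), and the latter reflects to one for `K`.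
[cite: Palais1960, Thm. B] -/
theorem noDisc_of_forall_not_isModelSliceDisc {k : ℕ} {K : 𝕊 1 → 𝔼 4}
    (hK : ∀ t, K t ∈ modelBoundary k) (h : ∀ g, ¬ IsModelSliceDisc k K g) : NoDisc k K := by
  intro N _ _ _ _ _ hN e' f' hd
  obtain ⟨Θ⟩ := hN
  obtain ⟨g, hg | hg⟩ :=
    Theorems.DcrGfgmw.exists_isModelSliceDisc_or_mirror_of_diffeomorph hK Θ hd
  · exact h g hg
  · have h2 : IsModelSliceDisc k (modelMirror ∘ (modelMirror ∘ K)) (modelMirror ∘ g) :=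
      hg.modelMirror_comp
    have hKK : modelMirror ∘ (modelMirror ∘ K) = K := by
      funext t
      simp [Function.comp_apply]
    rw [hKK] at h2
    exact h _ h2

/-- **NORMAL FORM OF THE NO-DISC CLAUSE.** For a circle on `∂D_k` the clause "in no `N ≅ S⁴`, for no
chart `e'`, does `e' ∘ K` bound a disc off `e'(D_k)`" is EQUIVALENT to "`K` bounds no smooth proper
disc in `ℝ⁴ ∖ D_k`" (`MMSW.IsModelSliceDisc`). All the carrier / atlas / diffeomorphism / chart /
chirality freedom of the clause is absorbed. [cite: Palais1960, Thm. B] -/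
theorem noDisc_iff {k : ℕ} {K : 𝕊 1 → 𝔼 4} (hK : ∀ t, K t ∈ modelBoundary k) :
    NoDisc k K ↔ ∀ g, ¬ IsModelSliceDisc k K g :=
  ⟨fun h _ hg => not_noDisc_of_isModelSliceDisc hg h, noDisc_of_forall_not_isModelSliceDisc hK⟩

/-- **THE CRUX IN NORMAL FORM**: `DcrGap` holds iff some model knot `K ⊂ ∂D_k` is slice in the
`D_k`-complement of some homotopy 4-sphere but bounds NO smooth proper disc in `ℝ⁴ ∖ D_k`.
[cite: Palais1960, Thm. B] -/
theorem dcrGap_iff_modelForm :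
    DcrGap ↔ ∃ (k : ℕ) (K : 𝕊 1 → 𝔼 4),
      IsModelKnot k K ∧ HomotopySphereSlice k K ∧ ∀ g, ¬ IsModelSliceDisc k K g := by
  rw [dcrGap_iff]
  constructor
  · rintro ⟨k, K, hK, hS, hN⟩
    exact ⟨k, K, hK, hS, (noDisc_iff hK.mem).1 hN⟩
  · rintro ⟨k, K, hK, hS, hN⟩
    exact ⟨k, K, hK, hS, (noDisc_iff hK.mem).2 hN⟩

/-- **THE KILL SWITCH IN NORMAL FORM** (what a refutation of the crux must deliver):
`DcrRigidity` (= `¬ DcrGap`) iff every model knot that is slice in the `D_k`-complement of some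
homotopy 4-sphere bounds a smooth proper disc in `ℝ⁴ ∖ D_k`. [cite: Palais1960, Thm. B] -/
theorem dcrRigidity_iff_modelForm :
    DcrRigidity ↔ ∀ (k : ℕ) (K : 𝕊 1 → 𝔼 4),
      IsModelKnot k K → HomotopySphereSlice k K → ∃ g, IsModelSliceDisc k K g := by
  rw [dcrRigidity_iff, dcrGap_iff_modelForm]
  simp only [not_exists, not_and, not_forall, not_not]

/-! ## §2 Load-bearing hypotheses of the no-disc clause -/

/-- The no-disc clause with `Nonempty (N ≃ₘ S⁴)` WEAKENED to `Nonempty (N ≃ₕ S⁴)` (homotopy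
equivalence instead of diffeomorphism). [folklore] -/
def NoDiscHomotopy (k : ℕ) (K : 𝕊 1 → 𝔼 4) : Prop :=
  ∀ (N : Type) [TopologicalSpace N] [T2Space N] [SecondCountableTopology N]
    [ChartedSpace (𝔼 4) N] [IsManifold (𝓡 4) ∞ N],
    Nonempty (ContinuousMap.HomotopyEquiv N (𝕊 4)) →
      ∀ (e' : 𝔼 4 → N) (f' : 𝔼 2 → N), ¬ IsSliceDiscInComplement k K N e' f'

/-- `DcrGap` with the diffeomorphism hypothesis of its no-disc clause weakened to homotopy
equivalence. [folklore] -/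
def DcrGapWithoutDiffeo : Prop :=
  ∃ (k : ℕ) (K : 𝕊 1 → 𝔼 4), IsModelKnot k K ∧ HomotopySphereSlice k K ∧ NoDiscHomotopy k K

/-- **`Nonempty (N ≃ₘ S⁴)` is load-bearing**: weakened to `N ≃ₕ S⁴` the crux is FALSE — the
witnessing homotopy sphere `M` is itself an admissible `N` and its datum `(e, f)` violates the
clause. (So the gap, if it exists, is invisible to anything that does not see the smooth structure
of `N`; any proof of the crux must use `≃ₘ`, not merely `≃ₕ`.) [folklore] -/
theorem dcrGap_false_without_diffeo : ¬ DcrGapWithoutDiffeo := by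
  rintro ⟨k, K, -, ⟨M, _, _, _, _, _, hM, e, f, hef⟩, hno⟩
  exact hno M hM e f hef

/-- The weakened clause implies the honest one (a diffeomorphism is a homotopy equivalence), so
`DcrGapWithoutDiffeo → DcrGap` trivially — recorded to make plain that §2 weakens the right
clause. [folklore] -/
theorem noDisc_of_noDiscHomotopy {k : ℕ} {K : 𝕊 1 → 𝔼 4} (h : NoDiscHomotopy k K) : NoDisc k K :=
  fun N _ _ _ _ _ ⟨Θ⟩ e' f' => h N ⟨Θ.toHomeomorph.toHomotopyEquiv⟩ e' f'

/-! ## §3 The SPC4 shield -/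

/-- **`SmoothPoincare4 → ¬ DcrGap`** (contrapositive of the route's certified deciding theorem
`closes`): the crux cannot be refuted by anything weaker than a rigidity theorem that SPC4 would
give for free, and a proof of it is a disproof of the summit. [folklore] -/
theorem not_dcrGap_of_spc4 (hS : _root_.SmoothPoincare4) : ¬ DcrGap := fun hX => closes hX hS

/-- **Every witness of the crux is an exotic 4-sphere**: the homotopy sphere `M` of a `DcrGap`
datum admits no diffeomorphism to `S⁴` (else `N := M` violates the no-disc clause). [folklore] -/
theorem isEmpty_diffeomorph_of_witness {k : ℕ} {K : 𝕊 1 → 𝔼 4} (hno : NoDisc k K)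
    {M : Type} [TopologicalSpace M] [T2Space M] [SecondCountableTopology M]
    [ChartedSpace (𝔼 4) M] [IsManifold (𝓡 4) ∞ M] {e : 𝔼 4 → M} {f : 𝔼 2 → M}
    (hef : IsSliceDiscInComplement k K M e f) : IsEmpty (M ≃ₘ⟮𝓡 4, 𝓡 4⟯ (𝕊 4)) :=
  ⟨fun Φ => hno M ⟨Φ⟩ e f hef⟩


/-- **Slice data travel along smooth embeddings, so a witness circle is dotted-slice in NO
4-manifold that embeds in `S⁴`** (landed: `Theorems/DcrGap/Negative/NoEmbedding.lean`, p130705):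
if `(e, f)` is a datum for `K` in any smooth 4-manifold `X` (open or not — `ℝ⁴`, an open subset
of `S⁴`, a punctured homotopy sphere, a regular neighbourhood of `e(D_k) ∪ disc`) and `J : X → N`
is a smooth embedding into some `N ≅ S⁴`, then `(J ∘ e, J ∘ f)` violates the no-disc clause
(`DcrGfgmw.isSliceDiscInComplement_comp`).  Candidate supply dies, invariant-free, as soon as such
a neighbourhood is shown to embed in `S⁴`. [folklore] -/
theorem not_noDisc_of_isSmoothEmbedding {X : Type*} [TopologicalSpace X] [ChartedSpace (𝔼 4) X]
    [IsManifold (𝓡 4) ∞ X] {k : ℕ} {K : 𝕊 1 → 𝔼 4} {e : 𝔼 4 → X} {f : 𝔼 2 → X}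
    (h : IsSliceDiscInComplement k K X e f) {N : Type} [TopologicalSpace N] [T2Space N]
    [SecondCountableTopology N] [ChartedSpace (𝔼 4) N] [IsManifold (𝓡 4) ∞ N]
    (hN : Nonempty (N ≃ₘ⟮𝓡 4, 𝓡 4⟯ (𝕊 4))) {J : X → N}
    (hJ : Manifold.IsSmoothEmbedding (𝓡 4) (𝓡 4) ∞ J) : ¬ NoDisc k K := fun hno =>
  hno N hN (J ∘ e) (J ∘ f) (Theorems.DcrGfgmw.isSliceDiscInComplement_comp h hJ)

/-- **For a witness circle, no carrier of any of its slice data embeds in `S⁴`.** [folklore] -/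
theorem not_isSmoothEmbedding_of_witness {k : ℕ} {K : 𝕊 1 → 𝔼 4} (hno : NoDisc k K)
    {X : Type*} [TopologicalSpace X] [ChartedSpace (𝔼 4) X] [IsManifold (𝓡 4) ∞ X]
    {e : 𝔼 4 → X} {f : 𝔼 2 → X} (h : IsSliceDiscInComplement k K X e f) (J : X → 𝕊 4) :
    ¬ Manifold.IsSmoothEmbedding (𝓡 4) (𝓡 4) ∞ J := fun hJ =>
  not_noDisc_of_isSmoothEmbedding h ⟨Diffeomorph.refl _ _ _⟩ hJ hno

/-! ## §4 The hardness pin: the `k = 0` layer is the FGMW question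

The development below is LANDED verbatim as `Theorems/DcrGap/Negative/KZeroIsFgmw.lean` (p130570,
namespace `Summit.SmoothPoincare4.SmoothPoincare4.Theorems.DcrGap.Negative`); it is inlined here
(namespace `…Disproof.KZero`) only so that this work file elaborates independently of the farm's
build of that module. -/

namespace KZero


/-! ## The `k = 0` model is the solid ellipsoid `L(B̄⁴)`, `L = diag(40, 40, 1, 1)` -/

/-- **The scaling `L = diag(40, 40, 1, 1)` exists** as a continuous linear automorphism of `ℝ⁴`
(stated through its four coordinate identities, which is all that is used below). [folklore] -/
theorem exists_scaling :
    ∃ L : EuclideanSpace ℝ (Fin 4) ≃L[ℝ] EuclideanSpace ℝ (Fin 4),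
      ∀ x, L x 0 = 40 * x 0 ∧ L x 1 = 40 * x 1 ∧ L x 2 = x 2 ∧ L x 3 = x 3 := by
  refine ⟨LinearEquiv.toContinuousLinearEquiv
    { toFun := fun x => !₂[40 * x 0, 40 * x 1, x 2, x 3]
      map_add' := fun x y => by
        ext i; fin_cases i <;> simp [mul_add]
      map_smul' := fun c x => by
        ext i; fin_cases i <;> simp [mul_left_comm]
      invFun := fun x => !₂[x 0 / 40, x 1 / 40, x 2, x 3]
      left_inv := fun x => by
        ext i; fin_cases i <;> simp
      right_inv := fun x => by
        ext i; fin_cases i <;> simp [mul_div_cancel₀] }, fun x => ⟨?_, ?_, ?_, ?_⟩⟩ <;>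
  simp

section Scaling

variable {L : EuclideanSpace ℝ (Fin 4) ≃L[ℝ] EuclideanSpace ℝ (Fin 4)}
  (hL : ∀ x, L x 0 = 40 * x 0 ∧ L x 1 = 40 * x 1 ∧ L x 2 = x 2 ∧ L x 3 = x 3)
include hL

/-- `G_0(L y) = ‖y‖²` for the scaling `L`. [folklore] -/
theorem levelFun_zero_scaling (y : EuclideanSpace ℝ (Fin 4)) : levelFun 0 (L y) = ‖y‖ ^ 2 := by
  obtain ⟨h0, h1, h2, h3⟩ := hL y
  rw [EuclideanSpace.norm_sq_eq]
  simp only [levelFun, Finset.univ_eq_empty, Finset.sum_empty, add_zero, Nat.cast_zero, zero_add,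
    mul_one, h0, h1, h2, h3, Real.norm_eq_abs, sq_abs, Fin.sum_univ_four]
  ring

/-- `L y ∈ D_0 ↔ ‖y‖ ≤ 1`: the `k = 0` model handlebody is the solid ellipsoid `L(B̄⁴)`. [folklore] -/
theorem scaling_mem_modelHandlebody_zero_iff (y : EuclideanSpace ℝ (Fin 4)) :
    L y ∈ modelHandlebody 0 ↔ ‖y‖ ≤ 1 := by
  rw [mem_modelHandlebody_iff, levelFun_zero_scaling hL]
  simp only [IsEmpty.forall_iff, true_and]
  exact sq_le_one_iff₀ (norm_nonneg y)

/-- `L y ∈ ∂D_0 ↔ ‖y‖ = 1`: the `k = 0` model boundary is the ellipsoid `L(S³)`. [folklore] -/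
theorem scaling_mem_modelBoundary_zero_iff (y : EuclideanSpace ℝ (Fin 4)) :
    L y ∈ modelBoundary 0 ↔ ‖y‖ = 1 := by
  rw [mem_modelBoundary_iff, levelFun_zero_scaling hL]
  simp only [IsEmpty.forall_iff, true_and]
  exact pow_eq_one_iff_of_nonneg (norm_nonneg y) two_ne_zero

/-- `D_0 = L(B̄⁴)`. [folklore] -/
theorem image_scaling_closedBall :
    (L : EuclideanSpace ℝ (Fin 4) → EuclideanSpace ℝ (Fin 4)) ''
        Metric.closedBall (0 : EuclideanSpace ℝ (Fin 4)) 1 = modelHandlebody 0 := by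
  ext x
  constructor
  · rintro ⟨y, hy, rfl⟩
    exact (scaling_mem_modelHandlebody_zero_iff hL y).2 (mem_closedBall_zero_iff.1 hy)
  · intro hx
    refine ⟨L.symm x, ?_, L.apply_symm_apply x⟩
    rw [mem_closedBall_zero_iff, ← scaling_mem_modelHandlebody_zero_iff hL, L.apply_symm_apply]
    exact hx

/-! ## A knot `K ⊂ S³`, rescaled onto `∂D_0`, is a model knot -/

/-- **A knot in `S³`, rescaled onto `∂D_0` by `L`, is a model knot** (`MMSW.IsModelKnot 0`):
smooth, injective, immersed (chain rule with the linear automorphism `L`), on the level set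
`G_0 = 1`. [folklore] -/
theorem isModelKnot_scaling_comp (K : Knot) :
    IsModelKnot 0 ((L : EuclideanSpace ℝ (Fin 4) → EuclideanSpace ℝ (Fin 4)) ∘ fun t =>
      ((K t : Metric.sphere (0 : EuclideanSpace ℝ (Fin 4)) 1) : EuclideanSpace ℝ (Fin 4))) := by
  have hLs : ContMDiff 𝓘(ℝ, EuclideanSpace ℝ (Fin 4)) 𝓘(ℝ, EuclideanSpace ℝ (Fin 4)) ∞
      (L : EuclideanSpace ℝ (Fin 4) → EuclideanSpace ℝ (Fin 4)) :=
    (L : EuclideanSpace ℝ (Fin 4) →L[ℝ] EuclideanSpace ℝ (Fin 4)).contDiff.contMDiff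
  refine ⟨hLs.comp K.contMDiff_coe_comp,
    L.injective.comp (Subtype.val_injective.comp K.injective), fun t => ?_,
    fun t => (scaling_mem_modelBoundary_zero_iff hL _).2 (norm_eq_of_mem_sphere (K t))⟩
  have h1 : MDifferentiableAt 𝓘(ℝ, EuclideanSpace ℝ (Fin 4)) 𝓘(ℝ, EuclideanSpace ℝ (Fin 4))
      (L : EuclideanSpace ℝ (Fin 4) → EuclideanSpace ℝ (Fin 4))
      ((K t : Metric.sphere (0 : EuclideanSpace ℝ (Fin 4)) 1) : EuclideanSpace ℝ (Fin 4)) :=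
    hLs.mdifferentiableAt (by simp)
  have h2 : MDifferentiableAt (𝓡 1) 𝓘(ℝ, EuclideanSpace ℝ (Fin 4))
      (fun t => ((K t : Metric.sphere (0 : EuclideanSpace ℝ (Fin 4)) 1) : EuclideanSpace ℝ (Fin 4)))
      t :=
    K.contMDiff_coe_comp.mdifferentiableAt (by simp)
  rw [mfderiv_comp t h1 h2, mfderiv_eq_fderiv, L.fderiv]
  exact L.injective.comp (K.mfderiv_coe_comp_injective t)

/-! ## Bridge between the two disc predicates at `k = 0` -/

omit hL in
/-- **H-slice data are `k = 0` dotted-slice data.** For any linear automorphism `L` with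
`L(B̄⁴) = D_0`, a slice disc for `K` in `X ∖ e(B̊⁴)` (`Knot.IsSliceDiscIn K X e f`) is a slice
datum for the rescaled knot `L ∘ K` in the complement of the `k = 0` model handlebody, with chart
`e ∘ L⁻¹`. [folklore] -/
theorem isSliceDiscInComplement_zero_of_isSliceDiscIn
    (hD : ∀ y, L y ∈ modelHandlebody 0 ↔ ‖y‖ ≤ 1) {X : Type*} [TopologicalSpace X]
    [ChartedSpace (EuclideanSpace ℝ (Fin 4)) X] [IsManifold (𝓡 4) ∞ X] {K : Knot}
    {e : EuclideanSpace ℝ (Fin 4) → X} {f : EuclideanSpace ℝ (Fin 2) → X}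
    (h : K.IsSliceDiscIn X e f) :
    IsSliceDiscInComplement 0
      ((L : EuclideanSpace ℝ (Fin 4) → EuclideanSpace ℝ (Fin 4)) ∘ fun t =>
        ((K t : Metric.sphere (0 : EuclideanSpace ℝ (Fin 4)) 1) : EuclideanSpace ℝ (Fin 4)))
      X (e ∘ (L.symm : EuclideanSpace ℝ (Fin 4) → EuclideanSpace ℝ (Fin 4))) f := by
  obtain ⟨he, hf, hinj, hmf, hout, hb⟩ := h
  refine ⟨?_, hf, hinj, hmf, fun x hx hmem => ?_, fun t => ?_⟩
  · simpa using he.comp_diffeomorph L.symm.toDiffeomorph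
  · obtain ⟨y, hy, hyx⟩ := hmem
    refine hout x hx ⟨L.symm y, ?_, hyx⟩
    have h' := hD (L.symm y)
    rw [L.apply_symm_apply] at h'
    exact mem_closedBall_zero_iff.2 (h'.1 hy)
  · simp only [Function.comp_apply, ContinuousLinearEquiv.symm_apply_apply]
    exact hb t

omit hL in
/-- **`k = 0` dotted-slice data are H-slice data.** Conversely a slice datum for the rescaled
knot `L ∘ K` in the complement of `e(D_0)` is a slice disc for `K` in `X ∖ (e ∘ L)(B̊⁴)`.
[folklore] -/
theorem isSliceDiscIn_of_isSliceDiscInComplement_zero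
    (hD : ∀ y, L y ∈ modelHandlebody 0 ↔ ‖y‖ ≤ 1) {X : Type*} [TopologicalSpace X]
    [ChartedSpace (EuclideanSpace ℝ (Fin 4)) X] [IsManifold (𝓡 4) ∞ X] {K : Knot}
    {e : EuclideanSpace ℝ (Fin 4) → X} {f : EuclideanSpace ℝ (Fin 2) → X}
    (h : IsSliceDiscInComplement 0
      ((L : EuclideanSpace ℝ (Fin 4) → EuclideanSpace ℝ (Fin 4)) ∘ fun t =>
        ((K t : Metric.sphere (0 : EuclideanSpace ℝ (Fin 4)) 1) : EuclideanSpace ℝ (Fin 4))) X e f) :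
    K.IsSliceDiscIn X (e ∘ (L : EuclideanSpace ℝ (Fin 4) → EuclideanSpace ℝ (Fin 4))) f := by
  obtain ⟨he, hf, hinj, hmf, hout, hb⟩ := h
  refine ⟨?_, hf, hinj, hmf, fun x hx hmem => ?_, fun t => hb t⟩
  · simpa using he.comp_diffeomorph L.toDiffeomorph
  · obtain ⟨y, hy, hyx⟩ := hmem
    exact hout x hx ⟨L y, (hD y).2 (mem_closedBall_zero_iff.1 hy), hyx⟩

end Scaling

/-! ## The hardness pin -/

/-- **`¬ DcrGap` settles the FGMW question**: if the crux fails, EVERY knot that is slice in a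
homotopy 4-ball is slice in `B⁴` — i.e. the Freedman–Gompf–Morrison–Walker / Manolescu–Piccirillo
strategy against SPC4 is void (MMSW Question 9.11 at `k = 0`).  Proof: an H-slice datum for `K`
in a homotopy sphere `M` is a `k = 0` dotted-slice datum for the rescaled knot `L ∘ K ⊂ ∂D_0`
(`isSliceDiscInComplement_zero_of_isSliceDiscIn`); `¬ DcrGap` makes the no-disc clause fail for
it, and the datum so obtained in some `N ≅ S⁴` is standardised (Palais) to a MODEL slice disc for
`L ∘ K` in `ℝ⁴ ∖ D_0`; pushed into `S⁴` along a stereographic chart and un-scaled it is a slice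
disc for `K` in `S⁴ ∖ σ⁻¹L(B̊⁴)` (`isSliceDiscIn_of_isSliceDiscInComplement_zero`), which Palais'
ball-complement theorem and neatening (`Knot.palais_ballComplement_sphere_four_holds`,
`Knot.isSmoothlySlice_of_isProperDisc_holds`) turn into a slice disc in `B⁴`.
[cite: FreedmanGompfMorrisonWalker2010, §1] [cite: Palais1960, Thm. B] -/
theorem isSmoothlySlice_of_isHomotopyBallSlice_of_not_dcrGap (hX : ¬ DcrGap) (K : Knot)
    (hK : K.IsHomotopyBallSlice) : K.IsSmoothlySlice := by
  obtain ⟨L, hL⟩ := exists_scaling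
  have hD := scaling_mem_modelHandlebody_zero_iff hL
  set K' : Metric.sphere (0 : EuclideanSpace ℝ (Fin 2)) 1 → EuclideanSpace ℝ (Fin 4) :=
    (L : EuclideanSpace ℝ (Fin 4) → EuclideanSpace ℝ (Fin 4)) ∘ fun t =>
      ((K t : Metric.sphere (0 : EuclideanSpace ℝ (Fin 4)) 1) : EuclideanSpace ℝ (Fin 4)) with hK'
  obtain ⟨M, _, _, _, _, _, _, hM, e, f, hef⟩ := hK
  have hmk : IsModelKnot 0 K' := isModelKnot_scaling_comp hL K
  have hdat : IsSliceDiscInComplement 0 K' M _ f := isSliceDiscInComplement_zero_of_isSliceDiscIn hD hef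
  -- `¬ DcrGap`: the no-disc clause FAILS for the rescaled knot, i.e. some `N ≅ S⁴` carries a datum
  have hno : ¬ ∀ (N : Type) [TopologicalSpace N] [T2Space N] [SecondCountableTopology N]
      [ChartedSpace (EuclideanSpace ℝ (Fin 4)) N] [IsManifold (𝓡 4) ∞ N],
      Nonempty (N ≃ₘ⟮𝓡 4, 𝓡 4⟯ (Metric.sphere (0 : EuclideanSpace ℝ (Fin 5)) 1)) →
        ∀ (e' : EuclideanSpace ℝ (Fin 4) → N) (f' : EuclideanSpace ℝ (Fin 2) → N),
          ¬ IsSliceDiscInComplement 0 K' N e' f' :=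
    fun h => hX ⟨0, K', hmk, ⟨M, _, ‹_›, ‹_›, _, ‹_›, hM, _, f, hdat⟩, h⟩
  simp only [not_forall, not_not] at hno
  obtain ⟨N, _, _, _, _, _, ⟨Θ⟩, e', f', hd⟩ := hno
  -- standardise it (Palais, `DcrGfgmw.exists_isModelSliceDisc_or_mirror_of_diffeomorph`) to a
  -- MODEL slice disc for the rescaled knot, the mirror being absorbed by `ρ ∘ ρ = id`
  -- (this is `Negative.noDisc_iff_forall_not_isModelSliceDisc` of `NoDiscNormalForm.lean`)
  obtain ⟨g, hg⟩ : ∃ g, IsModelSliceDisc 0 K' g := by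
    obtain ⟨g, hg | hg⟩ :=
      Theorems.DcrGfgmw.exists_isModelSliceDisc_or_mirror_of_diffeomorph hmk.mem Θ hd
    · exact ⟨g, hg⟩
    · refine ⟨modelMirror ∘ g, ?_⟩
      have h2 : IsModelSliceDisc 0 (modelMirror ∘ (modelMirror ∘ K')) (modelMirror ∘ g) :=
        hg.modelMirror_comp
      have hKK : modelMirror ∘ (modelMirror ∘ K') = K' := by
        funext t
        simp [Function.comp_apply]
      rwa [hKK] at h2
  -- push it into `S⁴` and un-scale
  have hS := hg.isSliceDiscInComplement_chartAt_symm
    (⟨EuclideanSpace.single 0 1, by simp⟩ : Metric.sphere (0 : EuclideanSpace ℝ (Fin 5)) 1)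
  have hIn := isSliceDiscIn_of_isSliceDiscInComplement_zero hD hS
  -- Palais' complementary ball and neatening
  obtain ⟨U, c, hc₁, hc₂⟩ := Knot.palais_ballComplement_sphere_four_holds _ hIn.isSmoothEmbedding
  obtain ⟨g', hg'⟩ := hIn.exists_isProperDisc c hc₁ hc₂
  exact Knot.isSmoothlySlice_of_isProperDisc_holds K g' hg'

/-- **Contrapositive, FGMW form**: a knot slice in a homotopy 4-ball but not in `B⁴` (the FGMW /
Manolescu–Piccirillo certificate, e.g. route `ZeroSurgeryExotic`'s waypoint) proves the crux at
`k = 0` — so refuting `DcrGap` is AT LEAST as hard as refuting the whole FGMW strategy.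
[cite: FreedmanGompfMorrisonWalker2010, §1] -/
theorem not_fgmw_of_not_dcrGap (hX : ¬ DcrGap) :
    ¬ ∃ K : Knot, K.IsHomotopyBallSlice ∧ ¬ K.IsSmoothlySlice := fun ⟨K, hb, hs⟩ =>
  hs (isSmoothlySlice_of_isHomotopyBallSlice_of_not_dcrGap hX K hb)


end KZero

/-! ### Corollaries in the vocabulary of the other route and of the barrier catalogue -/

/-- **`¬ DcrGap` ⇒ every H-slice knot is slice** (landed:
`Theorems.DcrGap.Negative.isSmoothlySlice_of_isHomotopyBallSlice_of_not_dcrGap`). The `k = 0` model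
`D_0` is the solid ellipsoid `L(B̄⁴)`, `L = diag(40,40,1,1)`, and `Knot.IsSliceDiscIn K X e f ↔
MMSW.IsSliceDiscInComplement 0 (L ∘ K) X (e ∘ L⁻¹) f` exactly; `¬ DcrGap` in normal form hands the
rescaled knot a model slice disc, which Palais + neatening turn into a slice disc in `B⁴`.
[cite: FreedmanGompfMorrisonWalker2010, §1] [cite: Palais1960, Thm. B] -/
theorem isSmoothlySlice_of_isHomotopyBallSlice_of_not_dcrGap (hX : ¬ DcrGap) (K : Knot)
    (hK : K.IsHomotopyBallSlice) : K.IsSmoothlySlice :=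
  KZero.isSmoothlySlice_of_isHomotopyBallSlice_of_not_dcrGap hX K hK

/-- **A refutation of the crux refutes route `ZeroSurgeryExotic`'s waypoint `ZseHsliceNotSlice`**
(`∃ K : Knot, K.IsHomotopyBallSlice ∧ ¬ K.IsSmoothlySlice`, stated here verbatim to avoid importing
that route): the FGMW gap at `k = 0` is a special case of the one-handle slice gap.
[cite: FreedmanGompfMorrisonWalker2010, §1] -/
theorem not_zseHsliceNotSlice_of_not_dcrGap (hX : ¬ DcrGap) :
    ¬ ∃ K : Knot, K.IsHomotopyBallSlice ∧ ¬ K.IsSmoothlySlice :=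
  KZero.not_fgmw_of_not_dcrGap hX

/-- **A refutation of the crux answers MMSW Question 9.11 (knots) positively**, modulo Rasmussen's
slice theorem `s(slice) = 0` (tree fact `eq_zero_of_isSmoothlySlice`, Rasmussen 2010 Thm. 1): every
knot slice in a homotopy 4-ball would be slice, hence have `s = 0`.  `MMSW2023Question911Knot` is
the barrier catalogue's registered OPEN statement (`Literature.Barriers.SmoothPoincare4.GluckTwistsDissolve`).
[cite: ManolescuMarengonSarkarWillis2023, Question 9.11] [cite: Rasmussen2010, Thm. 1] -/
theorem question911Knot_of_not_dcrGap (hX : ¬ DcrGap) (hs0 : eq_zero_of_isSmoothlySlice) :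
    Literature.Barriers.SmoothPoincare4.MMSW2023Question911Knot :=
  fun K hK _ hs => hs0 hs (isSmoothlySlice_of_isHomotopyBallSlice_of_not_dcrGap hX K hK)

/-- **… and voids the FGMW `s`-strategy** (`FGMWRasmussenStrategy` of the barrier catalogue: some
H-slice knot with `s ≠ 0`), modulo the same fact. [cite: FreedmanGompfMorrisonWalker2010, §1] -/
theorem not_fgmwRasmussenStrategy_of_not_dcrGap (hX : ¬ DcrGap) (hs0 : eq_zero_of_isSmoothlySlice) :
    ¬ Literature.Barriers.SmoothPoincare4.FGMWRasmussenStrategy := by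
  rintro ⟨K, hK, s, hs, hs0'⟩
  exact hs0' (question911Knot_of_not_dcrGap hX hs0 K hK s hs)

/-! ## §5 Why it resists; near-misses (prose)

* SANDWICH.  `SmoothPoincare4 → ¬ DcrGap` (§3) and `¬ DcrGap → (every H-slice knot is slice)` (§4).
  Both ends are open; the lower end is MMSW Question 9.11 / Kirby-list level ("is every knot that
  is slice in a homotopy 4-ball slice?"), for which no rigidity technique is known (light-bulb /
  concordance arguments stop at homotopy balls; gauge theory and `s` are conjecturally blind but
  blindness of an INVARIANT would not produce the DISC a refutation needs, `dcrRigidity_iff_modelForm`).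
  Hence: no kill is available, and none is expected short of SPC4-strength input.
* DEGENERATE REGIMES.  `k = 0`: = FGMW (§4).  Junk circles: a constant `K` has no datum (`InjOn f`
  on the closed disc vs `f|S¹` constant); a circle inside `D_k°` has no datum (interior points of
  the disc near `S¹` would enter the open set `e(D_k°)`); a circle off `D_k` altogether is excluded
  by `IsModelKnot`'s membership clause — were it dropped, such a circle still needs a separating
  disc, so the weakening is not cheap either (remark for the planner: the smoothness / injectivity /
  immersion clauses of `IsModelKnot` are implied by the datum, since `K = e⁻¹ ∘ f|S¹` with `e` a
  diffeomorphism onto an open set; only the membership clause `K ⊂ ∂D_k` is independent, and it is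
  what the ENGINE needs, not the gap).
* CHIRALITY / CARRIER / ATLAS freedom of the no-disc clause: absorbed (§1).  `≃ₘ ↦ ≃ₕ`: false (§2).
* `k = 1` RUNG (support item `DcrGapOne`): Davis–Nagel–Park–Ray (JLMS 2018, Thm. 1: winding-±1 knots
  in `S¹ × S²` are smoothly concordant to `S¹ × pt`) shows winding-±1 model circles on `∂D_1` always
  bound discs in `D² × S² = S⁴ ∖ D_1°`, so they are never witnesses; this constrains WITNESSES, it
  does not refute the rung (winding `0` and `|w| ≥ 2` remain), and the tree has no concordance
  vocabulary in `S¹ × S²` to formalise it — recorded, not typed.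
* LITERATURE (2026-08-16; local searchd reset / OpenAlex 429 / arXiv 0 rows during this session —
  relying on the planner's and ideators' same-day searches recorded in the route file and in
  `IdeatorR1K1NegativeNotes.md`): no `M_k`-rigidity theorem for slice discs in homotopy
  `♮ᵏ(B² × S²)`'s is in print; MMSW §9.3 poses the `k = 0` case as Question 9.11.
-/

end Summit.SmoothPoincare4.SmoothPoincare4.Cruxes.DcrGap.Disproof

end
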